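import Summits.QuantumFields.YangMills.Theorems.IR.TypFormatBootstrap
import HarnessLib

/-!
# Crux `IR` (stmt-QuantumFields-19354), lane B: GRADE ROBUSTNESS of the typical-class onset, the SHARPENED uniform insensitivity
# of the centre cell under format Uc, and the WEAK-WIRE kill

Helper module for item `stmt-QuantumFields-19354` (`--supports`; it closes nothing).  Route-independent (tree mirrors
`OnsetFormatsUc.*` of `Theorems/IR/Negative/TypShellCondUKPcFalseOfWildWire.lean`; no Theses import).

Consequences of the typical bootstrap `TypBootstrap.typShellCondUKPc_bootstrap` (`Theorems/IR/TypFormatBootstrap.lean`):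

* §1 `exists_bootstrap_exponent_lt` (geometric beats quartic, any target), **`typOnsetFamily_window_robust`** — a typical-onset
  FAMILY `∀ δ > 0, ∃ β₂, ∀ β ≥ β₂, ∃ b ≥ 1, P β b ∧ TypShellCondUKPc ρ β b n ε δ` at ANY grade `(n, ε)` with `ε·shellCount n ≤ 1`
  yields the family at grade `(j(2n+1), ε')` for every `ε' > (ε·shellCount n)^j`, with the SAME side condition `P β b` (e.g. the
  calibration `a(β)·b < T` of the sharp format): the typical class's `∀ δ` absorbs the bad-cell term `j(2+3ε)Mδ`;
  **`onsetMixingTypicalUKPc_iff_lt_one`** — the registered admissibility `ε·shellCount n ≤ 3/4` of `OnsetMixingTypicalUKPc` can be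
  replaced by the Dobrushin–Shlosman threshold `< 1`, and **`onsetMixingTypicalUKPc_grade_free`** — by ANY target `τ > 0`.
* §2 **`abs_sub_le_of_typShellCondUKPc_bootstrap`** — the disprover's uniform insensitivity `2ε + 2·#shell·δ`
  (`abs_sub_le_of_typShellCondUKPc`, WildWire file) SHARPENED to `2((εM)^j + j(2+3ε)Mδ) + 2·#shell(j(2n+1))·δ` on regions
  containing the `(2j(2n+1)+2)`-collar block: under format Uc the centre cell is insensitive to EVERYTHING outside a thick
  collar, exponentially in the thickness, up to the rarity budget — the lead's located «Uc ⇒ uniform: constant does not close»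
  is repaired for full-collar regions (NOT for sub-regions with wild agreeing exteriors: that is the typical class's residual content).
* §3 **`typOnsetFamily_false_of_uniformGapWire`**, **`not_onsetMixingTypicalUKPc_of_uniformGapWire`** — a β- and mesh-uniform
  wire of ANY fixed polarisation gap `g > 0` (two exteriors moving one centre-cell event by `≥ g` through every region containing
  the collar block, at every mesh `b ≥ 1` and window `m ≥ 1` beyond `β₀`) refutes the typical onset at `(G, r)` — the WildWire
  kill (`onsetMixingTypicalUKPcAt_false_of_wildWire`, gap `1/3`) with the threshold removed.

HONEST FRAMING: format-level consequences among OPEN statements of one gap-crux of a CONDITIONAL chain; the typical onset is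
assumed in §1–§2 and refuted only MODULO a wire hypothesis in §3 (no wire is constructed here); not a gap, not Clay.
No `sorry`; axioms ⊆ {propext, Classical.choice, Quot.sound}.
-/

set_option autoImplicit false

noncomputable section

open MeasureTheory Filter Topology
open Literature.MathematicalPhysics
open Literature.MathematicalPhysics.QuantumFieldTheory Literature.MathematicalPhysics.QuantumLattice
open Literature.Probability.LatticeModels
open Summit.QuantumFields.YangMills.Cruxes.IR.Tempered (cellEdges windowCells regionEdges)
open Summit.QuantumFields.YangMills.Cruxes.IR.ShellTempered (windowCellsPlus)
open Summit.QuantumFields.YangMills.Cruxes.IR.OnsetFormats (shellCount)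
open Summit.QuantumFields.YangMills.Cruxes.IR.OnsetFormatsUc (IsFrame TypShellCondUKPc OnsetMixingTypicalUKPc collarBlock
  abs_sub_le_of_typShellCondUKPc)
open Summit.QuantumFields.YangMills.Cruxes.IR.OnsetFormatsUc.TypBootstrap (typShellCondUKPc_bootstrap typShellCondUKPc_mono)
open Summit.QuantumFields.YangMills.Cruxes.IR.AfPincerUc.Bootstrap (shellCount_le)

namespace Summit.QuantumFields.YangMills.Cruxes.IR.OnsetFormatsUc.TypRobust

/-! ## §1 Grade robustness of typical-onset families -/

/-- **Geometric beats quartic, any target**: for `0 ≤ q < 1`, `τ > 0` and any `n` there is `j ≥ 1` with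
`q^j · shellCount (j(2n+1)) < τ` (cf. `AfPincerUc.Bootstrap.exists_bootstrap_exponent`, target `3/4`). -/
theorem exists_bootstrap_exponent_lt {q τ : ℝ} (hq0 : 0 ≤ q) (hq1 : q < 1) (hτ : 0 < τ) (n : ℕ) :
    ∃ j : ℕ, 1 ≤ j ∧ q ^ j * shellCount (j * (2 * n + 1)) < τ := by
  set C : ℝ := (7 * (2 * (n : ℝ) + 1)) ^ 4 with hC
  have hCq : ∀ j : ℕ, 1 ≤ j → q ^ j * shellCount (j * (2 * n + 1)) ≤ C * ((j : ℝ) ^ 4 * q ^ j) := by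
    intro j hj
    have hj' : (1 : ℝ) ≤ j := by exact_mod_cast hj
    have hS := shellCount_le (j * (2 * n + 1))
    have hle : (4 * ((j * (2 * n + 1) : ℕ) : ℝ) + 3) ^ 4 ≤ C * (j : ℝ) ^ 4 := by
      have h7 : 4 * ((j * (2 * n + 1) : ℕ) : ℝ) + 3 ≤ 7 * (2 * (n : ℝ) + 1) * j := by
        push_cast
        nlinarith
      have h0 : 0 ≤ 4 * ((j * (2 * n + 1) : ℕ) : ℝ) + 3 := by positivity
      calc (4 * ((j * (2 * n + 1) : ℕ) : ℝ) + 3) ^ 4 ≤ (7 * (2 * (n : ℝ) + 1) * j) ^ 4 :=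
            pow_le_pow_left₀ h0 h7 4
        _ = C * (j : ℝ) ^ 4 := by rw [hC]; ring
    have hqj : 0 ≤ q ^ j := pow_nonneg hq0 j
    calc q ^ j * shellCount (j * (2 * n + 1)) ≤ q ^ j * (C * (j : ℝ) ^ 4) :=
          mul_le_mul_of_nonneg_left (hS.trans hle) hqj
      _ = C * ((j : ℝ) ^ 4 * q ^ j) := by ring
  have hlim : Tendsto (fun j : ℕ => C * ((j : ℝ) ^ 4 * q ^ j)) atTop (𝓝 0) := by
    have h := tendsto_pow_const_mul_const_pow_of_abs_lt_one 4 (abs_lt.2 ⟨by linarith, hq1⟩)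
    simpa using h.const_mul C
  obtain ⟨J, hJ⟩ := Metric.tendsto_atTop.1 hlim τ hτ
  refine ⟨max J 1, le_max_right _ _, ?_⟩
  have h1 := hJ (max J 1) (le_max_left _ _)
  rw [Real.dist_eq, sub_zero] at h1
  exact (hCq _ (le_max_right _ _)).trans_lt (lt_of_abs_lt h1)

section Robust

variable {G : Type} [Group G] [TopologicalSpace G] [IsTopologicalGroup G] [CompactSpace G]
  [MeasurableSpace G] [BorelSpace G] [SecondCountableTopology G] [T2Space G]
  {N : ℕ} {ρ : G →* Matrix (Fin N) (Fin N) ℂ}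

/-- **Window robustness of a typical-onset family (with a side condition).**  If `ρ` is continuous, `0 ≤ ε`, `ε·shellCount n ≤ 1`
and for every rarity budget `δ > 0` there are `β₂` and, for every `β ≥ β₂`, a mesh `b ≥ 1` with `P β b ∧ TypShellCondUKPc ρ β b n ε δ`,
then for every `j` and every `ε' > (ε·shellCount n)^j` the same holds at grade `(j(2n+1), ε')` — SAME meshes, SAME side condition
(`typShellCondUKPc_bootstrap` at the budget `min δ ((ε' − θ^j)/(jK+1))`, then monotonicity). -/
theorem typOnsetFamily_window_robust (hρ : Continuous ρ) {P : ℝ → ℕ → Prop} {n : ℕ} {ε : ℝ} (hε : 0 ≤ ε)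
    (hεM : ε * shellCount n ≤ 1)
    (h : ∀ δ : ℝ, 0 < δ → ∃ β₂ : ℝ, ∀ β : ℝ, β₂ ≤ β → ∃ b : ℕ, 1 ≤ b ∧ P β b ∧ TypShellCondUKPc ρ β b n ε δ)
    (j : ℕ) {ε' : ℝ} (hε' : (ε * shellCount n) ^ j < ε') :
    ∀ δ : ℝ, 0 < δ → ∃ β₂ : ℝ, ∀ β : ℝ, β₂ ≤ β → ∃ b : ℕ, 1 ≤ b ∧ P β b ∧ TypShellCondUKPc ρ β b (j * (2 * n + 1)) ε' δ := by
  intro δ hδ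
  set θ : ℝ := ε * shellCount n with hθ
  set K : ℝ := (2 + 3 * ε) * shellCount n with hK
  have hSn : 0 ≤ shellCount n := by
    unfold Summit.QuantumFields.YangMills.Cruxes.IR.OnsetFormats.shellCount; positivity
  have hK0 : 0 ≤ K := mul_nonneg (by linarith) hSn
  have hjK : 0 < (j : ℝ) * K + 1 := by positivity
  set δ₀ : ℝ := min δ ((ε' - θ ^ j) / ((j : ℝ) * K + 1)) with hδ₀
  have hδ₀pos : 0 < δ₀ := lt_min hδ (div_pos (by linarith) hjK)
  have hδ₀δ : δ₀ ≤ δ := min_le_left _ _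
  have hδ₀ε : θ ^ j + (j : ℝ) * ((2 + 3 * ε) * shellCount n * δ₀) ≤ ε' := by
    have h1 : δ₀ ≤ (ε' - θ ^ j) / ((j : ℝ) * K + 1) := min_le_right _ _
    have h2 : ((j : ℝ) * K) * δ₀ ≤ ((j : ℝ) * K) * ((ε' - θ ^ j) / ((j : ℝ) * K + 1)) :=
      mul_le_mul_of_nonneg_left h1 (by positivity)
    have h3 : ((j : ℝ) * K) * ((ε' - θ ^ j) / ((j : ℝ) * K + 1)) ≤ ε' - θ ^ j := by
      rw [mul_div_assoc']
      rw [div_le_iff₀ hjK]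
      nlinarith [hK0, (Nat.cast_nonneg j : (0 : ℝ) ≤ j)]
    have e : (j : ℝ) * ((2 + 3 * ε) * shellCount n * δ₀) = ((j : ℝ) * K) * δ₀ := by rw [hK]; ring
    rw [e]
    linarith
  obtain ⟨β₂, hβ⟩ := h δ₀ hδ₀pos
  refine ⟨β₂, fun β hb => ?_⟩
  obtain ⟨b, hb1, hP, hT⟩ := hβ β hb
  refine ⟨b, hb1, hP, ?_⟩
  exact typShellCondUKPc_mono ρ hδ₀ε hδ₀pos.le hδ₀δ (typShellCondUKPc_bootstrap ρ hρ hb1 hε hεM hδ₀pos.le hT j)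

/-- **Grade freedom of a typical-onset family**: under the hypotheses of `typOnsetFamily_window_robust` with `ε·shellCount n < 1`,
for every target `τ > 0` there is a grade `(n', ε')` with `1 ≤ n'`, `0 < ε'`, `ε'·shellCount n' < τ` at which the family holds
(same meshes, same side condition). -/
theorem typOnsetFamily_grade_free (hρ : Continuous ρ) {P : ℝ → ℕ → Prop} {n : ℕ} {ε : ℝ} (hε : 0 ≤ ε)
    (hεM : ε * shellCount n < 1)
    (h : ∀ δ : ℝ, 0 < δ → ∃ β₂ : ℝ, ∀ β : ℝ, β₂ ≤ β → ∃ b : ℕ, 1 ≤ b ∧ P β b ∧ TypShellCondUKPc ρ β b n ε δ)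
    {τ : ℝ} (hτ : 0 < τ) :
    ∃ (n' : ℕ) (ε' : ℝ), 1 ≤ n' ∧ 0 < ε' ∧ ε' * shellCount n' < τ ∧
      ∀ δ : ℝ, 0 < δ → ∃ β₂ : ℝ, ∀ β : ℝ, β₂ ≤ β → ∃ b : ℕ, 1 ≤ b ∧ P β b ∧ TypShellCondUKPc ρ β b n' ε' δ := by
  have hSn : 0 ≤ shellCount n := by
    unfold Summit.QuantumFields.YangMills.Cruxes.IR.OnsetFormats.shellCount; positivity
  have hq0 : 0 ≤ ε * shellCount n := mul_nonneg hε hSn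
  obtain ⟨j, hj1, hj⟩ := exists_bootstrap_exponent_lt hq0 hεM (half_pos hτ) n
  set S : ℝ := shellCount (j * (2 * n + 1)) with hS
  have hS0 : 0 ≤ S := by
    rw [hS]; unfold Summit.QuantumFields.YangMills.Cruxes.IR.OnsetFormats.shellCount; positivity
  set ε' : ℝ := (ε * shellCount n) ^ j + τ / 2 / (S + 1) with hε'def
  have hη : 0 < τ / 2 / (S + 1) := by positivity
  have hε'gt : (ε * shellCount n) ^ j < ε' := by linarith
  refine ⟨j * (2 * n + 1), ε', ?_, ?_, ?_, typOnsetFamily_window_robust hρ hε hεM.le h j hε'gt⟩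
  · calc 1 ≤ j := hj1
      _ ≤ j * (2 * n + 1) := Nat.le_mul_of_pos_right j (by omega)
  · have : 0 ≤ (ε * shellCount n) ^ j := pow_nonneg hq0 j
    linarith
  · have h1 : τ / 2 / (S + 1) * S ≤ τ / 2 := by
      rw [div_mul_eq_mul_div, div_le_iff₀ (by positivity)]
      nlinarith [hS0, hτ]
    rw [hε'def, add_mul]
    linarith

end Robust

/-- **`OnsetMixingTypicalUKPc` with the Dobrushin–Shlosman threshold `< 1` in place of the registered `≤ 3/4`.**  The two are
EQUIVALENT (typical bootstrap + grade freedom at target `3/4`; the converse is `3/4 < 1`). -/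
theorem onsetMixingTypicalUKPc_iff_lt_one :
    OnsetMixingTypicalUKPc ↔
    ∀ (G : Type) [Group G] [TopologicalSpace G] [IsTopologicalGroup G] [CompactSpace G],
      IsCompactSimpleLieGroup G → letI : MeasurableSpace G := borel G; haveI : BorelSpace G := ⟨rfl⟩;
      ∀ r : LatticeRep G, ∃ (n : ℕ) (ε : ℝ), 1 ≤ n ∧ 0 ≤ ε ∧ ε * shellCount n < 1 ∧
        ∀ δ : ℝ, 0 < δ → ∃ β₂ : ℝ, ∀ β : ℝ, β₂ ≤ β → ∃ b : ℕ, 1 ≤ b ∧ TypShellCondUKPc r.ρ β b n ε δ := by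
  constructor
  · intro h G _ _ _ _ hG
    letI : MeasurableSpace G := borel G
    haveI : BorelSpace G := ⟨rfl⟩
    intro r
    obtain ⟨n, ε, hn, hε, hM, hfam⟩ := h G hG r
    exact ⟨n, ε, hn, hε, by linarith, hfam⟩
  · intro h G _ _ _ _ hG
    letI : MeasurableSpace G := borel G
    haveI : BorelSpace G := ⟨rfl⟩
    intro r
    haveI : T2Space G := T2Space.of_injective_continuous r.injective r.continuous
    haveI : SecondCountableTopology G :=
      (r.continuous.isClosedEmbedding r.injective).isEmbedding.secondCountableTopology
    obtain ⟨n, ε, hn, hε, hM, hfam⟩ := h G hG r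
    have hfam' : ∀ δ : ℝ, 0 < δ → ∃ β₂ : ℝ, ∀ β : ℝ, β₂ ≤ β → ∃ b : ℕ, 1 ≤ b ∧ True ∧ TypShellCondUKPc r.ρ β b n ε δ :=
      fun δ hδ => by
        obtain ⟨β₂, hβ⟩ := hfam δ hδ
        exact ⟨β₂, fun β hb => by obtain ⟨b, hb1, hT⟩ := hβ β hb; exact ⟨b, hb1, trivial, hT⟩⟩
    obtain ⟨n', ε', hn', hε', hlt, hfam''⟩ :=
      typOnsetFamily_grade_free (P := fun _ _ => True) r.continuous hε hM hfam' (by norm_num : (0 : ℝ) < 3 / 4)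
    refine ⟨n', ε', hn', hε'.le, hlt.le, fun δ hδ => ?_⟩
    obtain ⟨β₂, hβ⟩ := hfam'' δ hδ
    exact ⟨β₂, fun β hb => by obtain ⟨b, hb1, -, hT⟩ := hβ β hb; exact ⟨b, hb1, hT⟩⟩

/-- **Grade freedom of `OnsetMixingTypicalUKPc`**: it implies, for every `(G, r)` and EVERY target `τ > 0`, a typical-onset family at
a grade `(n', ε')` with `ε'·shellCount n' < τ` (the registered constant `3/4` is immaterial). -/
theorem onsetMixingTypicalUKPc_grade_free (h : OnsetMixingTypicalUKPc) (G : Type) [Group G] [TopologicalSpace G]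
    [IsTopologicalGroup G] [CompactSpace G] (hG : IsCompactSimpleLieGroup G) {τ : ℝ} (hτ : 0 < τ) :
    letI : MeasurableSpace G := borel G; haveI : BorelSpace G := ⟨rfl⟩;
    ∀ r : LatticeRep G, ∃ (n : ℕ) (ε : ℝ), 1 ≤ n ∧ 0 < ε ∧ ε * shellCount n < τ ∧
      ∀ δ : ℝ, 0 < δ → ∃ β₂ : ℝ, ∀ β : ℝ, β₂ ≤ β → ∃ b : ℕ, 1 ≤ b ∧ TypShellCondUKPc r.ρ β b n ε δ := by
  letI : MeasurableSpace G := borel G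
  haveI : BorelSpace G := ⟨rfl⟩
  intro r
  haveI : T2Space G := T2Space.of_injective_continuous r.injective r.continuous
  haveI : SecondCountableTopology G :=
    (r.continuous.isClosedEmbedding r.injective).isEmbedding.secondCountableTopology
  obtain ⟨n, ε, _, hε, hM, hfam⟩ := h G hG r
  have hfam' : ∀ δ : ℝ, 0 < δ → ∃ β₂ : ℝ, ∀ β : ℝ, β₂ ≤ β → ∃ b : ℕ, 1 ≤ b ∧ True ∧ TypShellCondUKPc r.ρ β b n ε δ :=
    fun δ hδ => by
      obtain ⟨β₂, hβ⟩ := hfam δ hδ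
      exact ⟨β₂, fun β hb => by obtain ⟨b, hb1, hT⟩ := hβ β hb; exact ⟨b, hb1, trivial, hT⟩⟩
  obtain ⟨n', ε', hn', hε', hlt, hfam''⟩ :=
    typOnsetFamily_grade_free (P := fun _ _ => True) r.continuous hε (by linarith) hfam' hτ
  refine ⟨n', ε', hn', hε', hlt, fun δ hδ => ?_⟩
  obtain ⟨β₂, hβ⟩ := hfam'' δ hδ
  exact ⟨β₂, fun β hb => by obtain ⟨b, hb1, -, hT⟩ := hβ β hb; exact ⟨b, hb1, hT⟩⟩

/-! ## §2 The sharpened uniform insensitivity of the centre cell under format Uc -/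

section Insensitivity

variable {G : Type} [Group G] [TopologicalSpace G] [IsTopologicalGroup G] [CompactSpace G]
  [MeasurableSpace G] [BorelSpace G] [T2Space G] [SecondCountableTopology G]
  {N : ℕ} {ρ : G →* Matrix (Fin N) (Fin N) ℂ}

/-- **FORMAT Uc FORCES EXPONENTIAL BOUNDARY-CONDITION INSENSITIVITY OF THE CENTRE CELL AT FULL COLLARS.**  If
`TypShellCondUKPc ρ β b n ε δ` (`b ≥ 1`, `0 ≤ ε`, `ε·shellCount n ≤ 1`, `0 ≤ δ`), then for every `j`, every mesh-`b` frame `w`, every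
measurable centre-cell event `A`, every finite region `F' ⊇ collarBlock (j(2n+1))` and EVERY two exterior data `ζ, ζ'`:
`|γ_{F'}(ζ)(A) − γ_{F'}(ζ')(A)| ≤ 2((εM)^j + j(2+3ε)Mδ) + 2·#shell(j(2n+1))·δ` — the disprover's `abs_sub_le_of_typShellCondUKPc`
(bound `2ε + 2·#shell·δ`) after the typical bootstrap. -/
theorem abs_sub_le_of_typShellCondUKPc_bootstrap (hρ : Continuous ρ) {β : ℝ} {b n : ℕ} {ε δ : ℝ} (hb : 1 ≤ b)
    (hT : TypShellCondUKPc ρ β b n ε δ) (hε : 0 ≤ ε) (hεM : ε * shellCount n ≤ 1) (hδ : 0 ≤ δ) (j : ℕ)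
    {w : Fin 4 → ℤ → ℤ} (hw : IsFrame b w) {A : Set (LGConfig 4 G)} (hA : MeasurableSet A)
    (hAdep : DependsOn (fun σ : LGConfig 4 G => σ ∈ A) ↑(cellEdges w 0))
    {F' : Finset (Fin 4 → ℤ)} (hF' : collarBlock (j * (2 * n + 1)) ⊆ F') (ζ ζ' : LGConfig 4 G) :
    |(ymSpecification ρ β (regionEdges w F') ζ).real A - (ymSpecification ρ β (regionEdges w F') ζ').real A| ≤
      2 * ((ε * shellCount n) ^ j + j * ((2 + 3 * ε) * shellCount n * δ)) +
        2 * ((((windowCellsPlus (j * (2 * n + 1)) \ windowCells (j * (2 * n + 1))).card : ℝ)) * δ) := by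
  have hε' : 0 ≤ (ε * shellCount n) ^ j + j * ((2 + 3 * ε) * shellCount n * δ) := by
    have hSn : 0 ≤ shellCount n := by
      unfold Summit.QuantumFields.YangMills.Cruxes.IR.OnsetFormats.shellCount; positivity
    have h1 : 0 ≤ (ε * shellCount n) ^ j := pow_nonneg (mul_nonneg hε hSn) j
    have h2 : 0 ≤ (j : ℝ) * ((2 + 3 * ε) * shellCount n * δ) :=
      mul_nonneg (Nat.cast_nonneg _) (mul_nonneg (mul_nonneg (by linarith) hSn) hδ)
    linarith
  exact abs_sub_le_of_typShellCondUKPc hρ (typShellCondUKPc_bootstrap ρ hρ hb hε hεM hδ hT j) hε' hδ hw hA hAdep hF' ζ ζ'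

/-- **A gap-`g` wire at ONE parameter point refutes format Uc there** once `2((εM)^j + j(2+3ε)Mδ) + 2·#shell(j(2n+1))·δ < g`:
two exteriors moving one measurable centre-cell event by `≥ g` through a region containing `collarBlock (j(2n+1))`. -/
theorem not_typShellCondUKPc_of_gapWire (hρ : Continuous ρ) {β : ℝ} {b n : ℕ} {ε δ g : ℝ} (hb : 1 ≤ b) (hε : 0 ≤ ε)
    (hεM : ε * shellCount n ≤ 1) (hδ : 0 ≤ δ) (j : ℕ)
    (hwire : ∃ w : Fin 4 → ℤ → ℤ, IsFrame b w ∧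
      ∃ (A : Set (LGConfig 4 G)) (F' : Finset (Fin 4 → ℤ)) (ζ₀ ζ₁ : LGConfig 4 G),
        MeasurableSet A ∧ DependsOn (fun σ : LGConfig 4 G => σ ∈ A) ↑(cellEdges w 0) ∧ collarBlock (j * (2 * n + 1)) ⊆ F' ∧
        g ≤ (ymSpecification ρ β (regionEdges w F') ζ₁).real A - (ymSpecification ρ β (regionEdges w F') ζ₀).real A)
    (hsmall : 2 * ((ε * shellCount n) ^ j + j * ((2 + 3 * ε) * shellCount n * δ)) +
        2 * ((((windowCellsPlus (j * (2 * n + 1)) \ windowCells (j * (2 * n + 1))).card : ℝ)) * δ) < g) :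
    ¬ TypShellCondUKPc ρ β b n ε δ := by
  intro hT
  obtain ⟨w, hw, A, F', ζ₀, ζ₁, hA, hAdep, hF', hgap⟩ := hwire
  have h := abs_sub_le_of_typShellCondUKPc_bootstrap hρ hb hT hε hεM hδ j hw hA hAdep hF' ζ₁ ζ₀
  have h' := le_abs_self ((ymSpecification ρ β (regionEdges w F') ζ₁).real A -
    (ymSpecification ρ β (regionEdges w F') ζ₀).real A)
  linarith

/-! ## §3 The weak-wire kill of the typical onset -/

/-- **A β- and mesh-uniform wire of ANY fixed gap `g > 0` refutes the typical onset at `(G, ρ)`**: if beyond `β₀`, at every mesh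
`b ≥ 1` and every window `m ≥ 1`, some mesh-`b` frame carries two exteriors moving a measurable centre-cell event by `≥ g` through a
region containing `collarBlock m`, then NO admissible `(n, ε)` carries the typical-onset family (for `(n, ε)`: bootstrap to the
window `j(2n+1)` with `2(ε·shellCount n)^j < g/3`, then a budget `δ` with `2j(2+3ε)Mδ + 2·#shell·δ < 2g/3`).  Generalises
`onsetMixingTypicalUKPcAt_false_of_wildWire` (gap `1/3`). -/
theorem typOnsetFamily_false_of_uniformGapWire (hρ : Continuous ρ) {g : ℝ} (hg : 0 < g)
    (hW : ∃ β₀ : ℝ, ∀ β : ℝ, β₀ ≤ β → ∀ b m : ℕ, 1 ≤ b → 1 ≤ m →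
      ∃ w : Fin 4 → ℤ → ℤ, IsFrame b w ∧
        ∃ (A : Set (LGConfig 4 G)) (F' : Finset (Fin 4 → ℤ)) (ζ₀ ζ₁ : LGConfig 4 G),
          MeasurableSet A ∧ DependsOn (fun σ : LGConfig 4 G => σ ∈ A) ↑(cellEdges w 0) ∧ collarBlock m ⊆ F' ∧
          g ≤ (ymSpecification ρ β (regionEdges w F') ζ₁).real A - (ymSpecification ρ β (regionEdges w F') ζ₀).real A) :
    ¬ ∃ (n : ℕ) (ε : ℝ), 1 ≤ n ∧ 0 ≤ ε ∧ ε * shellCount n ≤ 3 / 4 ∧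
        ∀ δ : ℝ, 0 < δ → ∃ β₂ : ℝ, ∀ β : ℝ, β₂ ≤ β → ∃ b : ℕ, 1 ≤ b ∧ TypShellCondUKPc ρ β b n ε δ := by
  rintro ⟨n, ε, hn, hε, hM, hfam⟩
  obtain ⟨β₀, hwire⟩ := hW
  set q : ℝ := ε * shellCount n with hq
  have hSn : 0 ≤ shellCount n := by
    unfold Summit.QuantumFields.YangMills.Cruxes.IR.OnsetFormats.shellCount; positivity
  have hq0 : 0 ≤ q := mul_nonneg hε hSn
  have hq1 : q < 1 := by linarith
  -- the bootstrap exponent: `2 q^j < g/3`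
  obtain ⟨j₀, hj₀⟩ := exists_pow_lt_of_lt_one (show 0 < g / 6 by positivity) hq1
  set j : ℕ := max j₀ 1 with hj
  have hj1 : 1 ≤ j := le_max_right _ _
  have hqj : q ^ j < g / 6 := (pow_le_pow_of_le_one hq0 hq1.le (le_max_left _ _)).trans_lt hj₀
  set m : ℕ := j * (2 * n + 1) with hm
  have hm1 : 1 ≤ m := le_trans hj1 (Nat.le_mul_of_pos_right j (by omega))
  -- the rarity budget
  set K : ℝ := (j : ℝ) * ((2 + 3 * ε) * shellCount n) with hK
  set k : ℝ := (((windowCellsPlus m \ windowCells m).card : ℝ)) with hk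
  have hK0 : 0 ≤ K := mul_nonneg (Nat.cast_nonneg _) (mul_nonneg (by linarith) hSn)
  have hk0 : 0 ≤ k := Nat.cast_nonneg _
  set δ : ℝ := g / (6 * (K + k + 1)) with hδ
  have hKk : 0 < K + k + 1 := by positivity
  have hδ0 : 0 < δ := by positivity
  have hKδ : (K + k) * δ < g / 3 := by
    rw [hδ, mul_div_assoc', div_lt_iff₀ (by positivity)]
    nlinarith [hK0, hk0, hg]
  obtain ⟨β₂, hβ⟩ := hfam δ hδ0
  obtain ⟨b, hb1, hT⟩ := hβ (max β₀ β₂) (le_max_right _ _)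
  refine not_typShellCondUKPc_of_gapWire hρ hb1 hε hq1.le hδ0.le j
    (hwire (max β₀ β₂) (le_max_left _ _) b m hb1 hm1) ?_ hT
  have e : 2 * (q ^ j + (j : ℝ) * ((2 + 3 * ε) * shellCount n * δ)) + 2 * (k * δ) = 2 * q ^ j + 2 * ((K + k) * δ) := by
    rw [hK]; ring
  rw [e]
  linarith

end Insensitivity

/-- **A uniform gap wire for ONE lattice representation of ONE compact simple `G` refutes `OnsetMixingTypicalUKPc`**
(any gap `g > 0`; Hausdorff and second countability of `G` come from the faithful representation `r`). -/
theorem not_onsetMixingTypicalUKPc_of_uniformGapWire (G : Type) [Group G] [TopologicalSpace G] [IsTopologicalGroup G]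
    [CompactSpace G] (hG : IsCompactSimpleLieGroup G)
    (hW : letI : MeasurableSpace G := borel G; haveI : BorelSpace G := ⟨rfl⟩;
      ∃ (r : LatticeRep G) (g : ℝ), 0 < g ∧ ∃ β₀ : ℝ, ∀ β : ℝ, β₀ ≤ β → ∀ b m : ℕ, 1 ≤ b → 1 ≤ m →
        ∃ w : Fin 4 → ℤ → ℤ, IsFrame b w ∧
          ∃ (A : Set (LGConfig 4 G)) (F' : Finset (Fin 4 → ℤ)) (ζ₀ ζ₁ : LGConfig 4 G),
            MeasurableSet A ∧ DependsOn (fun σ : LGConfig 4 G => σ ∈ A) ↑(cellEdges w 0) ∧ collarBlock m ⊆ F' ∧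
            g ≤ (ymSpecification r.ρ β (regionEdges w F') ζ₁).real A -
              (ymSpecification r.ρ β (regionEdges w F') ζ₀).real A) :
    ¬ OnsetMixingTypicalUKPc := by
  intro hI
  letI : MeasurableSpace G := borel G
  haveI : BorelSpace G := ⟨rfl⟩
  obtain ⟨r, g, hg, hWr⟩ := hW
  haveI : T2Space G := T2Space.of_injective_continuous r.injective r.continuous
  haveI : SecondCountableTopology G :=
    (r.continuous.isClosedEmbedding r.injective).isEmbedding.secondCountableTopology
  exact typOnsetFamily_false_of_uniformGapWire r.continuous hg hWr (hI G hG r)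

end Summit.QuantumFields.YangMills.Cruxes.IR.OnsetFormatsUc.TypRobust

end
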